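import Mathlib
import HarnessLib
import Summits.HubbardSuperconductivity.HubbardSuperconductivity.Theorems.KLProgrammeKLRegimeAlphaWtClosed
import Summits.HubbardSuperconductivity.HubbardSuperconductivity.Theorems.KLProgrammeKLRegimeSectorSliceAlphaWtRows

/-!
# Route `KLProgramme` — engine support, route (L2), FAT layer, WEIGHTED: **`α_w` for the fat sector family in CLOSED FORM** — the
# `klScaleWt`-weighted row and column sums `hrow/hcol` of `EngineV8.klNormsStepWt_of_sliceConsts` for `S(F̃)ᵀ·C^K_{(Λ,Λ′]}·S(F̃)`,
# `Λ = klScale e₀ (m+1)`, weight scale `nw` dominated by the canonical rates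

Cell `gate-hubbard-kl`, seat p3 (g10); program «W3α = α_w rows instance», file (α2c): weighted twin of k3c2-p3's `…AlphaFatClosedRows`, from
`slicePairWt_bgmFat_closed` (file (α2b)) and `rowSumWt/colSumWt_sliceCT_bgmFat_le_of_pairBound` (file (α3)).

* **`rowSumWt_sliceCT_bgmFat_closed`**, **`colSumWt_sliceCT_bgmFat_closed`** — if `Λ_{nw}^{klE0}β/(2M) ≤ D·s₀`, `Λ_{nw}^{klE0} ≤ D·s₁`, `1 ≤ D`
  (`s₀ = 2Λβ/(MπX₀)`, `s₁ = 2Λ/(πX₁)`): `Σ_{Y′} ‖(S(F̃)ᵀ C S(F̃)) Y Y′‖·klScaleWt L M β nw {pos Y, pos Y′} ≤ 8·9·D·4√(48·C_W·C_N)·(M/β)/Λ`.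

Everything is proved; no definitions. [cite: BenfattoGiulianiMastropietro2006, §2.8 (2.81), §3 (3.3)]
-/

noncomputable section

namespace Summit.HubbardSuperconductivity.HubbardSuperconductivity.Theorems.TorusFourierL2

set_option linter.dupNamespace false -- summit = problem name (single-conjunct summit), D-0017

open Set Finset Literature.MathematicalPhysics.QuantumLattice Literature.MathematicalPhysics.QuantumLattice.BandSectorCounting
open Literature.MathematicalPhysics.QuantumLattice.FermiRG Literature.Probability.LatticeModels Literature.Analysis.SpecialFunctions
open Summit.HubbardSuperconductivity.HubbardSuperconductivity.Theorems.DispersionFlow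
open Summit.HubbardSuperconductivity.HubbardSuperconductivity.Theorems.KLRegimeSplit
open Summit.HubbardSuperconductivity.HubbardSuperconductivity.Theorems.KLProgrammeLegKernels
open Summit.HubbardSuperconductivity.HubbardSuperconductivity.Theorems.PerturbedFermiCurve
open Summit.HubbardSuperconductivity.HubbardSuperconductivity.Theorems.EngineV8
open scoped Real Nat

section Closed

open Classical

variable {L M : ℕ} [NeZero L] [NeZero M] {a b : ℝ} (B : BandBounds a b) {K : TrigPolyC4v} {A : ℝ}
  (hA : ∀ p : Momentum, ∀ j ≤ 2, ‖iteratedFDeriv ℝ j (frameShift K) p‖ ≤ A) (hADt : 2 * A < B.Dtmin)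
  {μ e₀ z β : ℝ} (he : 0 < e₀) (hz : 0 < z) (hz1 : z ≤ 1) (hgap : e₀ + A + z ^ 2 < -μ) (h3 : e₀ + A - μ ≤ 3)
  (hlo : a ≤ μ - A - e₀) (hhi : μ + A + e₀ ≤ b) (hβ : 0 < β) (hρA : 4 * A < 2 * B.rhomin)
  (m : ℕ) (hMm : klScale e₀ m * β < π * (2 * M - 5))
  {d : ℝ} (hd : 0 ≤ d) (hd1 : ∀ u, |deriv (bgmCutoffSq e₀) u| ≤ d) (hd2 : ∀ u, |iteratedDeriv 2 (bgmCutoffSq e₀) u| ≤ d)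
  (hd3 : ∀ u, |iteratedDeriv 3 (bgmCutoffSq e₀) u| ≤ d)
  {A₃ a₃ : ℝ} (hA3 : ∀ p : Momentum, ‖iteratedFDeriv ℝ 3 (frameShift K) p‖ ≤ A₃) (ha3 : A₃ * klScale e₀ m ^ 2 ≤ a₃)
  {Ba : ℝ} (hB0 : 0 ≤ Ba)
  (hB : ∀ (i : ℕ), i ≤ 2 → ∀ (n : ℕ) (ω : ℤ) (θ₀ : ℝ) (q w : Fin 2 → ℝ) (t : ℝ) {r₀ : ℝ}, 0 < r₀ →
    r₀ ≤ ‖momToComplex (q + t • w)‖ → |sectorRelAngle θ₀ (q + t • w)| < π →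
    ‖iteratedDeriv i (fun t : ℝ => sectorWeightCirc n ω (polarAngle (q + t • w))) t‖ ≤
      (2 : ℕ)! * Ba * ((1 + (sectorWidth n)⁻¹ * (2 : ℕ)!) * ‖momToComplex w‖ / r₀) ^ i)
  {Ba3 : ℝ} (hB30 : 0 ≤ Ba3)
  (hB3 : ∀ (i : ℕ), i ≤ 3 → ∀ (n : ℕ) (ω : ℤ) (θ₀ : ℝ) (q w : Fin 2 → ℝ) (t : ℝ) {r₀ : ℝ}, 0 < r₀ →
    r₀ ≤ ‖momToComplex (q + t • w)‖ → |sectorRelAngle θ₀ (q + t • w)| < π →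
    ‖iteratedDeriv i (fun t : ℝ => sectorWeightCirc n ω (polarAngle (q + t • w))) t‖ ≤
      (3 : ℕ)! * Ba3 * ((1 + (sectorWidth n)⁻¹ * (3 : ℕ)!) * ‖momToComplex w‖ / r₀) ^ i)
  {Λ' : ℝ} (hΛΛ' : klScale e₀ (m + 1) ≤ Λ') (hM' : Λ' < π * (2 * M - 5) / β)
  {K₁ K₂ K₃ : ℝ} (hK₁pos : 0 < K₁) (hK₁ : ∀ p, ‖fderiv ℝ (frameLevel μ K) p‖ ≤ K₁) (hK₂ : ∀ p, ‖iteratedFDeriv ℝ 2 (frameLevel μ K) p‖ ≤ K₂)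
  (hK₃ : ∀ p, ‖iteratedFDeriv ℝ 3 (frameLevel μ K) p‖ ≤ K₃)
  {B₁ B₂ B₃ : ℝ} (hB₁ : ∀ x, |deriv salmhoferCutoff x| ≤ B₁) (hB₂ : ∀ x, |deriv (deriv salmhoferCutoff) x| ≤ B₂)
  (hB₃ : ∀ x, |deriv (deriv (deriv salmhoferCutoff)) x| ≤ B₃)
  -- regime
  (he₁ : e₀ ≤ 1) (hβM : β ≤ (M : ℝ)) (hπβ : π ≤ klScale e₀ m * β)
  (hLz : 3 * |2 * π / L| * ((2 : ℝ) ^ (m + 1) + 1 / 2) ≤ z) (hLN : 2 * π * (2 : ℝ) ^ (m + 1) * ((2 : ℝ) ^ (m + 1) + 1 / 2) ≤ L)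
  (hL1 : (2 * B.rhomin - 4 * A) * π ≤ 2 * Real.sqrt 2 * L * klScale e₀ (m + 1))
  {R₀ : ℕ} (hR₀ : 2 * (2 * (2 : ℝ) ^ (m + 1) + 1) * (R₀ : ℝ) < L) (hR₀' : (L : ℝ) / (10 * (2 : ℝ) ^ (m + 1)) ≤ R₀)
  {δL : ℝ} (hδL : 0 < δL) (hΛL : δL ≤ klScale e₀ (m + 1) ^ 2 * L)
  -- the closed-form constants (instantiate with `rfl`)
  {cρ G₁ G₂ G₃ κ₃F Kp bτ ae1 ae2 av1 av2 qv Dt3 q3e q3v X₀ X₁ X₃ x₀ x₁ x₂ x₃ c₁ CW CN : ℝ}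
  (hcρ : cρ = (2 * e₀ / π + B.smax * B.Dtmin * (3 / 4)) / (B.Dtmin - 2 * A) + π * Real.sqrt 2 * (1 + (4 + 2 * A) / (B.Dtmin - 2 * A)))
  (hG₁ : G₁ = d * e₀ ^ 2 * 1 + 1 * (d * e₀ ^ 2)) (hG₂ : G₂ = d * e₀ ^ 4 * 1 + 2 * (d * e₀ ^ 2) * (d * e₀ ^ 2) + 1 * (d * e₀ ^ 4))
  (hG₃ : G₃ = d * e₀ ^ 6 * 1 + 3 * (d * e₀ ^ 4) * (d * e₀ ^ 2) + 3 * (d * e₀ ^ 2) * (d * e₀ ^ 4) + 1 * (d * e₀ ^ 6))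
  (hκ₃F : κ₃F = (8 * G₃ + 12 * G₂) * (4 + 2 * A) ^ 3 + (12 * G₂ + 6 * G₁) * (4 + 2 * A) * (4 + 4 * A) * e₀ +
      2 * G₁ * (4 * e₀ ^ 2 + 8 * a₃) +
      216 * 9 * Ba3 * ((4 * G₂ + 2 * G₁) * (4 + 2 * A) ^ 2 * (2 * e₀) + 2 * G₁ * (4 + 4 * A) * e₀ * (2 * e₀)) +
      216 * 9 * G₁ * (4 + 2 * A) * (12 * Ba3 + 72 * Ba3 ^ 2) * (2 * e₀) ^ 2 + 216 * 9 * (12 * Ba3 + 216 * Ba3 ^ 2) * (2 * e₀) ^ 3)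
  (hKp : Kp = 4 + 4 * A) (hbτ : bτ = 4 + 2 * A + 2 * K₂ * (cρ * π))
  (hae1 : ae1 = G₁ * (4 + 2 * A + Kp * (cρ * π + 2)) / 2 + 72 * Ba * e₀)
  (hae2 : ae2 = (4 * G₂ + 2 * G₁) * (4 + 2 * A + Kp * (cρ * π + 2)) ^ 2 / 16 + G₁ * Kp * e₀ / 2 +
    144 * G₁ * (4 + 2 * A + Kp * (cρ * π + 2)) * Ba * e₀ + 36 * (4 * Ba + 8 * Ba ^ 2) * e₀ ^ 2)
  (hav1 : av1 = G₁ * (4 + 2 * A + Kp * (cρ * π + 2)) / (2 * e₀) + 288 * Ba)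
  (hav2 : av2 = (4 * G₂ + 2 * G₁) * (4 + 2 * A + Kp * (cρ * π + 2)) ^ 2 / (16 * e₀ ^ 2) + G₁ * Kp / (2 * e₀) +
    144 * G₁ * (4 + 2 * A + Kp * (cρ * π + 2)) * Ba / e₀ + 144 * (4 * Ba + 8 * Ba ^ 2))
  (hqv : qv = (32 * B₂ + 144 * B₁ + 128) * (bτ + 8 * K₂) ^ 2 / (4 * e₀ ^ 2) + (16 * B₁ + 16) * K₂ / (2 * e₀) +
    av1 * (16 * B₁ + 16) * (bτ + 6 * K₂) / (2 * e₀) + av2)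
  (hDt3 : Dt3 = 2 * (64 * B₃ + 480 * B₂ + 1728 * B₁ + 1536) + 3 * G₁ * (32 * B₂ + 144 * B₁ + 128) +
    3 / 8 * (4 * G₂ + 2 * G₁) * (16 * B₁ + 16) + (8 * G₃ + 12 * G₂) / 8)
  (hq3e : q3e = (64 * B₃ + 480 * B₂ + 1728 * B₁ + 1536) * (Real.sqrt 2 * K₁ + 12 * K₂) ^ 3 / 4 +
    3 / 2 * (32 * B₂ + 144 * B₁ + 128) * K₂ * (Real.sqrt 2 * K₁ + 12 * K₂) * e₀ + Real.sqrt 2 / 2 * (16 * B₁ + 16) * K₃ * e₀ ^ 2 +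
    3 * ae1 * ((32 * B₂ + 144 * B₁ + 128) * (Real.sqrt 2 * K₁ + 10 * K₂) ^ 2 / 4 + (16 * B₁ + 16) * K₂ * e₀ / 2) +
    3 / 4 * ae2 * (16 * B₁ + 16) * (Real.sqrt 2 * K₁ + 8 * K₂) + κ₃F / 64)
  (hq3v : q3v = (64 * B₃ + 480 * B₂ + 1728 * B₁ + 1536) * (bτ + 12 * K₂) ^ 3 / 4 +
    3 / 2 * (32 * B₂ + 144 * B₁ + 128) * K₂ * (bτ + 12 * K₂) * e₀ + Real.sqrt 2 / 2 * (16 * B₁ + 16) * K₃ * e₀ ^ 2 +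
    3 * (e₀ * av1 / 2) * ((32 * B₂ + 144 * B₁ + 128) * (bτ + 10 * K₂) ^ 2 / 4 + (16 * B₁ + 16) * K₂ * e₀ / 2) +
    3 / 4 * (e₀ ^ 2 * av2) * (16 * B₁ + 16) * (bτ + 8 * K₂) + κ₃F / 64)
  (hX₀ : X₀ = max 1 Dt3) (hX₁ : X₁ = max 1 q3e) (hX₃ : X₃ = max 1 q3v)
  (hx₀ : x₀ = π * X₀ / 2) (hx₁ : x₁ = π * X₁ / 2) (hx₂ : x₂ = 5 * π / 4 * X₁) (hx₃ : x₃ = 5 * π / 4 * Real.sqrt qv)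
  (hc₁ : c₁ = 4 + Kp * cρ ^ 2 * π ^ 2 / e₀)
  (hCW : CW = 64 * (1 + 5 * Real.sqrt 2 + 5 * Real.sqrt 2 * X₃) ^ 2 *
    (4096 * x₀ * (4 * ((2 * Real.sqrt 2 * x₂ + 2) * (2 * Real.sqrt 2 * x₃ + 1)) + 160 * x₁ * (x₁ + 1) ^ 2 / δL)))
  (hCN : CN = 128 * c₁ * cρ / (π ^ 2 * (2 * B.rhomin - 4 * A)))

include B hA hADt he hz hz1 hgap h3 hlo hhi hβ hρA hMm hd hd1 hd2 hd3 hA3 ha3 hB0 hB hB30 hB3 hΛΛ' hM' hK₁pos hK₁ hK₂ hK₃ hB₁ hB₂ hB₃ he₁ hβM hπβ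
  hLz hLN hL1 hR₀ hR₀' hδL hΛL hcρ hG₁ hG₂ hG₃ hκ₃F hKp hbτ hae1 hae2 hav1 hav2 hqv hDt3 hq3e hq3v hX₀ hX₁ hX₃ hx₀ hx₁ hx₂ hx₃ hc₁ hCW hCN

set_option maxHeartbeats 3000000 in
/-- **`hrow_w` in closed form** (see the module docstring). [cite: BenfattoGiulianiMastropietro2006, §2.8 (2.81), §3 (3.3)] -/
theorem rowSumWt_sliceCT_bgmFat_closed (nw : ℕ) {D : ℝ} (hD : 1 ≤ D)
    (hdom₀ : klScale klE0 nw * β / (2 * M) ≤ D * (2 * klScale e₀ (m + 1) * β / ((M : ℝ) * π * X₀)))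
    (hdom₁ : klScale klE0 nw ≤ D * (2 * klScale e₀ (m + 1) / (π * X₁))) (Y : SpaceTimeIdx L M × SectorLeg (sectorCount (m + 1))) :
    ∑ Y' : SpaceTimeIdx L M × SectorLeg (sectorCount (m + 1)),
        ‖((sectorSubMatrix L M β (bgmFatMultiplier L M e₀ β (nambuXiCT L μ K) (m + 1))).transpose *
            hubbardCovSliceCT L M β μ 0 K (klScale e₀ (m + 1)) Λ' *
              sectorSubMatrix L M β (bgmFatMultiplier L M e₀ β (nambuXiCT L μ K) (m + 1))) Y Y'‖ *
          klScaleWt L M β nw {latticeLegPos (2 * (2 * M)) Y, latticeLegPos (2 * (2 * M)) Y'} ≤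
      8 * ((9 : ℕ) * (D * (4 * Real.sqrt (48 * CW * CN) * ((M : ℝ) / β) / klScale e₀ (m + 1)))) := by
  have hT := fun ω ω' => slicePairWt_bgmFat_closed B hA hADt he hz hz1 hgap h3 hlo hhi hβ hρA m hMm hd hd1 hd2 hd3 hA3 ha3 hB0 hB hB30 hB3
    hΛΛ' hM' hK₁pos hK₁ hK₂ hK₃ hB₁ hB₂ hB₃ he₁ hβM hπβ hLz hLN hL1 hR₀ hR₀' hδL hΛL hcρ hG₁ hG₂ hG₃ hκ₃F hKp hbτ hae1 hae2 hav1 hav2 hqv hDt3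
    hq3e hq3v hX₀ hX₁ hX₃ hx₀ hx₁ hx₂ hx₃ hc₁ hCW hCN ω ω'
  have hTmax : 0 ≤ 4 * Real.sqrt (48 * CW * CN) * ((M : ℝ) / β) / klScale e₀ (m + 1) := by
    refine le_trans (Finset.sum_nonneg fun zz _ => mul_nonneg ?_ (norm_nonneg _)) (hT ⟨0, sectorCount_pos _⟩ ⟨0, sectorCount_pos _⟩)
    have hΛ0 : 0 ≤ klScale e₀ (m + 1) := by rw [klScale]; positivity
    have hX₀0 : 0 ≤ X₀ := by rw [hX₀]; exact le_trans zero_le_one (le_max_left _ _)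
    have hX₁0 : 0 ≤ X₁ := by rw [hX₁]; exact le_trans zero_le_one (le_max_left _ _)
    positivity
  exact rowSumWt_sliceCT_bgmFat_le_of_pairBound hβ μ K (klScale e₀ (m + 1)) Λ' e₀ m nw hD hdom₀ hdom₁ hTmax hT Y

/-- **`hcol_w` in closed form** (the column twin). [cite: BenfattoGiulianiMastropietro2006, §2.8 (2.81), §3 (3.3)] -/
theorem colSumWt_sliceCT_bgmFat_closed (nw : ℕ) {D : ℝ} (hD : 1 ≤ D)
    (hdom₀ : klScale klE0 nw * β / (2 * M) ≤ D * (2 * klScale e₀ (m + 1) * β / ((M : ℝ) * π * X₀)))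
    (hdom₁ : klScale klE0 nw ≤ D * (2 * klScale e₀ (m + 1) / (π * X₁))) (Y' : SpaceTimeIdx L M × SectorLeg (sectorCount (m + 1))) :
    ∑ Y : SpaceTimeIdx L M × SectorLeg (sectorCount (m + 1)),
        ‖((sectorSubMatrix L M β (bgmFatMultiplier L M e₀ β (nambuXiCT L μ K) (m + 1))).transpose *
            hubbardCovSliceCT L M β μ 0 K (klScale e₀ (m + 1)) Λ' *
              sectorSubMatrix L M β (bgmFatMultiplier L M e₀ β (nambuXiCT L μ K) (m + 1))) Y Y'‖ *
          klScaleWt L M β nw {latticeLegPos (2 * (2 * M)) Y, latticeLegPos (2 * (2 * M)) Y'} ≤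
      8 * ((9 : ℕ) * (D * (4 * Real.sqrt (48 * CW * CN) * ((M : ℝ) / β) / klScale e₀ (m + 1)))) := by
  have hT := fun ω ω' => slicePairWt_bgmFat_closed B hA hADt he hz hz1 hgap h3 hlo hhi hβ hρA m hMm hd hd1 hd2 hd3 hA3 ha3 hB0 hB hB30 hB3
    hΛΛ' hM' hK₁pos hK₁ hK₂ hK₃ hB₁ hB₂ hB₃ he₁ hβM hπβ hLz hLN hL1 hR₀ hR₀' hδL hΛL hcρ hG₁ hG₂ hG₃ hκ₃F hKp hbτ hae1 hae2 hav1 hav2 hqv hDt3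
    hq3e hq3v hX₀ hX₁ hX₃ hx₀ hx₁ hx₂ hx₃ hc₁ hCW hCN ω ω'
  have hTmax : 0 ≤ 4 * Real.sqrt (48 * CW * CN) * ((M : ℝ) / β) / klScale e₀ (m + 1) := by
    refine le_trans (Finset.sum_nonneg fun zz _ => mul_nonneg ?_ (norm_nonneg _)) (hT ⟨0, sectorCount_pos _⟩ ⟨0, sectorCount_pos _⟩)
    have hΛ0 : 0 ≤ klScale e₀ (m + 1) := by rw [klScale]; positivity
    have hX₀0 : 0 ≤ X₀ := by rw [hX₀]; exact le_trans zero_le_one (le_max_left _ _)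
    have hX₁0 : 0 ≤ X₁ := by rw [hX₁]; exact le_trans zero_le_one (le_max_left _ _)
    positivity
  exact colSumWt_sliceCT_bgmFat_le_of_pairBound hβ μ K (klScale e₀ (m + 1)) Λ' e₀ m nw hD hdom₀ hdom₁ hTmax hT Y'

end Closed

end Summit.HubbardSuperconductivity.HubbardSuperconductivity.Theorems.TorusFourierL2

end
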